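import Mathlib

/-!
# Perturbed chains of step propagators: discrete Duhamel and the bootstrap bound (solo-blind s80, R8-box)

The certificate engine knows the step propagators `S l` of the linearised flow at a box centre and a
bound `G` on all their ordered partial products `Φ j i = S i * … * S (j+1)` (the node-to-node
propagators).  At another parameter in the box the steps are `S l + Δ l` with `∑ ‖Δ l‖ ≤ η`.  The
discrete Duhamel identity and a bootstrap give: all partial products of the perturbed chain are
bounded by `G / (1 - G η)` as soon as `G η < 1`.  This is the box version of the two-time bound
(`two_time_bound_of_nodes`), with no exponential of the log-norm anywhere.

* `perturbed_chain_duhamel` — `Ψ j i = Φ j i + ∑_{l ∈ [j, i)} Φ (l+1) i * Δ (l+1) * Ψ j l`;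
* `perturbed_chain_bound` — `‖Ψ j i‖ ≤ G / (1 - G η)` for all `j ≤ i ≤ n`.
-/

open Finset

namespace Summit.AnomalousDissipation.AnomalousDissipation.Theorems

variable {𝔸 : Type*} [NormedRing 𝔸]

/-- **Discrete Duhamel identity.**  If `Φ j j = 1`, `Φ j (i+1) = S (i+1) * Φ j i` and
`Ψ j j = 1`, `Ψ j (i+1) = (S (i+1) + Δ (i+1)) * Ψ j i` (for `j ≤ i`), then for `j ≤ i`
`Ψ j i = Φ j i + ∑ l ∈ Ico j i, Φ (l+1) i * Δ (l+1) * Ψ j l`. -/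
theorem perturbed_chain_duhamel {Φ Ψ : ℕ → ℕ → 𝔸} {S Δ : ℕ → 𝔸}
    (hΦ0 : ∀ j, Φ j j = 1) (hΦs : ∀ j i, j ≤ i → Φ j (i + 1) = S (i + 1) * Φ j i)
    (hΨ0 : ∀ j, Ψ j j = 1) (hΨs : ∀ j i, j ≤ i → Ψ j (i + 1) = (S (i + 1) + Δ (i + 1)) * Ψ j i)
    (j i : ℕ) (hji : j ≤ i) :
    Ψ j i = Φ j i + ∑ l ∈ Ico j i, Φ (l + 1) i * Δ (l + 1) * Ψ j l := by
  induction i, hji using Nat.le_induction with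
  | base => simp [hΨ0, hΦ0]
  | succ i hji ih =>
      rw [Finset.sum_Ico_succ_top hji, hΨs j i hji]
      -- rewrite the old sum's factors Φ (l+1) (i+1) = S (i+1) * Φ (l+1) i
      have hsum : ∑ l ∈ Ico j i, Φ (l + 1) (i + 1) * Δ (l + 1) * Ψ j l
          = S (i + 1) * ∑ l ∈ Ico j i, Φ (l + 1) i * Δ (l + 1) * Ψ j l := by
        rw [Finset.mul_sum]
        refine Finset.sum_congr rfl fun l hl => ?_
        have hl' : l + 1 ≤ i := (Finset.mem_Ico.mp hl).2
        rw [hΦs (l + 1) i hl']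
        simp only [mul_assoc]
      rw [hsum, hΦ0, one_mul, hΦs j i hji]
      calc (S (i + 1) + Δ (i + 1)) * Ψ j i
          = S (i + 1) * Ψ j i + Δ (i + 1) * Ψ j i := add_mul _ _ _
        _ = S (i + 1) * (Φ j i + ∑ l ∈ Ico j i, Φ (l + 1) i * Δ (l + 1) * Ψ j l)
              + Δ (i + 1) * Ψ j i := by rw [← ih]
        _ = S (i + 1) * Φ j i + (S (i + 1) * ∑ l ∈ Ico j i, Φ (l + 1) i * Δ (l + 1) * Ψ j l
              + Δ (i + 1) * Ψ j i) := by rw [mul_add, add_assoc]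

/-- **Bootstrap bound for a perturbed chain.**  With `Φ`, `Ψ` as in `perturbed_chain_duhamel`, if
all node-to-node products of the unperturbed chain satisfy `‖Φ j i‖ ≤ G` (`j ≤ i ≤ n`) and the
perturbations satisfy `∑_{l ≤ n} ‖Δ (l+1)‖ ≤ η` with `G η < 1` (`0 ≤ G`), then `‖Ψ j i‖ ≤ G / (1 - G η)` for
all `j ≤ i ≤ n`. -/
theorem perturbed_chain_bound {Φ Ψ : ℕ → ℕ → 𝔸} {S Δ : ℕ → 𝔸} {G η : ℝ} {n : ℕ}
    (hG : 0 ≤ G) (hGη : G * η < 1)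
    (hΦ0 : ∀ j, Φ j j = 1) (hΦs : ∀ j i, j ≤ i → Φ j (i + 1) = S (i + 1) * Φ j i)
    (hΨ0 : ∀ j, Ψ j j = 1) (hΨs : ∀ j i, j ≤ i → Ψ j (i + 1) = (S (i + 1) + Δ (i + 1)) * Ψ j i)
    (hΦG : ∀ j i, j ≤ i → i ≤ n → ‖Φ j i‖ ≤ G)
    (hΔ : ∑ l ∈ range (n + 1), ‖Δ (l + 1)‖ ≤ η) :
    ∀ j i, j ≤ i → i ≤ n → ‖Ψ j i‖ ≤ G / (1 - G * η) := by
  set B : ℝ := G / (1 - G * η) with hBdef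
  have hden : 0 < 1 - G * η := by linarith
  have hB0 : 0 ≤ B := div_nonneg hG hden.le
  have hBeq : G + G * η * B = B := by
    rw [hBdef]; field_simp; ring
  intro j i
  induction i using Nat.strong_induction_on generalizing j with
  | _ i ih =>
    intro hji hin
    rw [perturbed_chain_duhamel hΦ0 hΦs hΨ0 hΨs j i hji]
    have hterm : ∀ l ∈ Ico j i, ‖Φ (l + 1) i * Δ (l + 1) * Ψ j l‖ ≤ G * B * ‖Δ (l + 1)‖ := by
      intro l hl
      have hjl : j ≤ l := (Finset.mem_Ico.mp hl).1
      have hli : l < i := (Finset.mem_Ico.mp hl).2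
      have h1 : ‖Φ (l + 1) i‖ ≤ G := hΦG (l + 1) i hli (by omega)
      have h3 : ‖Ψ j l‖ ≤ B := ih l hli j hjl (by omega)
      calc ‖Φ (l + 1) i * Δ (l + 1) * Ψ j l‖
          ≤ ‖Φ (l + 1) i‖ * ‖Δ (l + 1)‖ * ‖Ψ j l‖ := by
              refine (norm_mul_le _ _).trans ?_
              exact mul_le_mul_of_nonneg_right (norm_mul_le _ _) (norm_nonneg _)
        _ ≤ G * ‖Δ (l + 1)‖ * B := by
              apply mul_le_mul (mul_le_mul_of_nonneg_right h1 (norm_nonneg _)) h3 (norm_nonneg _)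
              exact mul_nonneg hG (norm_nonneg _)
        _ = G * B * ‖Δ (l + 1)‖ := by ring
    have hsub : ∑ l ∈ Ico j i, ‖Δ (l + 1)‖ ≤ η := by
      refine le_trans (Finset.sum_le_sum_of_subset_of_nonneg ?_ ?_) hΔ
      · intro l hl
        have hli : l < i := (Finset.mem_Ico.mp hl).2
        exact Finset.mem_range.mpr (by omega)
      · intro l _ _; exact norm_nonneg _
    calc ‖Φ j i + ∑ l ∈ Ico j i, Φ (l + 1) i * Δ (l + 1) * Ψ j l‖
        ≤ ‖Φ j i‖ + ∑ l ∈ Ico j i, ‖Φ (l + 1) i * Δ (l + 1) * Ψ j l‖ :=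
            (norm_add_le _ _).trans (add_le_add le_rfl (norm_sum_le _ _))
      _ ≤ G + ∑ l ∈ Ico j i, G * B * ‖Δ (l + 1)‖ := add_le_add (hΦG j i hji hin) (Finset.sum_le_sum hterm)
      _ = G + G * B * ∑ l ∈ Ico j i, ‖Δ (l + 1)‖ := by rw [Finset.mul_sum]
      _ ≤ G + G * B * η := by
            have : 0 ≤ G * B := mul_nonneg hG hB0
            nlinarith [hsub]
      _ = B := by linear_combination hBeq

end Summit.AnomalousDissipation.AnomalousDissipation.Theorems
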